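import Summits.CriticalPhenomena.CardyFormulaZ2.Theorems.CardyBoundaryCoulombGasBoundaryDefectGaussianRStubClusterLocalityV2Part9
import Summits.CriticalPhenomena.CardyFormulaZ2.Theorems.CardyBoundaryCoulombGasBoundaryDefectGaussianRStubClusterLocalityV2Part10

/-!
# Stub `stub_clusterLocalityV2` of line `rainbow-monomials-in-excursion-kernels` — Part 11:
# the percolation half P1 for the family `(2;2)` — locality of the critical two-point function
# near a flat boundary (crux `BoundaryDefectGaussianR`, stmt-CriticalPhenomena-14132)

Critical bond percolation on `ℤ²`, notation of Part 10 (`hbox[n]`, `Arm[u, n]`). For a domain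
`W ⊆ ℤ²` that agrees with the upper half-plane `{v 1 ≥ 0}` on a large ball about the origin and
two row points `u, w` at scale `k`, the connection probability `P[u ↔ w in W]` is squeezed between
`P[u ↔ w in hbox[N]]` (monotonicity) and `(1 + θ) · P[u ↔ w in hbox[N]]` with `θ → 0` as
`N/k → ∞` (`twoPoint_core`): by the decomposition `s10_connectionDecomposition` (Part 9) a
connection inside `W` not inside the window `B(N)` forces two half-plane arms from `u` and `w` to
the level `N` (`arm_of_escape`), which cost `θ · P[u ↔ w in hbox[N]]` by `s12_twoArmBound`
(Part 10). Positivity comes from the open row segment (`real_openConnIn_row_pos`). Choosing the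
scales gives the scale-free locality statement at the origin (`twoPoint_locality_site`), and
translation invariance (`real_openConnIn_shift`) transcribes it into the `ℤ × ℤ` phrasing of the
registered stub with two anchors `a, a'` (`twoPoint_locality_Z2`, registered sub-goal
`s12_twoPointLocality`): `|log P_{1/2}[u ↔ w in V] - log P_{1/2}[u' ↔ w' in V']| ≤ ε` for
`M ≥ M₀(ε)`, uniformly in `m ≥ 1`. [folklore]
-/

noncomputable section

namespace Summit.CriticalPhenomena.CardyFormulaZ2.Cruxes.BoundaryDefectGaussianR.RainbowMonomialsInExcursionKernels

open MeasureTheory Set Literature.Probability.Percolation Literature.Probability.LatticeModels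

local notation3 "hbox[" n "]" => {v : Site 2 | 0 ≤ v 1 ∧ max |v 0| (v 1) ≤ n}
local notation3 "lvl[" n "]" => {v : Site 2 | max |v 0| (v 1) = n}
local notation3 "Arm[" u ", " n "]" => openCrossing hbox[n] {u} lvl[n]
local notation3 "μ" => bondPercolation (zdGraph 2) half

/-! ### The sup-norm and escaping paths -/

/-- The sup-norm `max |v 0| |v 1|` moves by at most one along an edge of `ℤ²`. [folklore] -/
theorem supNorm_le_of_adj (u v : Site 2) (h : (zdGraph 2).Adj u v) :
    max |v 0| |v 1| ≤ max |u 0| |u 1| + 1 := by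
  have h0 := zdGraph_adj_apply_le h 0
  have h1 := zdGraph_adj_apply_le h 1
  have a0 : |u 0| ≤ max |u 0| |u 1| := le_max_left _ _
  have a1 : |u 1| ≤ max |u 0| |u 1| := le_max_right _ _
  rw [abs_le] at a0 a1
  refine max_le ?_ ?_ <;> rw [abs_le] <;> constructor <;> omega

/-- **An escaping path contains an arm.** If `W` agrees with the upper half-plane on the
sup-norm ball of radius `N`, then, on a lattice configuration, an open path inside `W` from a
point `u` of that ball to a point `z` outside it contains an open arm inside `hbox[N]` from `u`
to the level `N` (the path up to its first visit to sup-norm `N` runs in `W ∩ {‖·‖_∞ ≤ N}`, which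
lies in the upper half-plane). [folklore] -/
theorem arm_of_escape {ω : BondConfig (Site 2)} (hω : ω ⊆ (zdGraph 2).edgeSet) {W : Set (Site 2)}
    {N : ℕ} (hW : ∀ v : Site 2, max |v 0| |v 1| ≤ N → (v ∈ W ↔ 0 ≤ v 1)) {u z : Site 2}
    (hu : max |u 0| |u 1| ≤ N) (hz : z ∉ (↑(box 2 N) : Set (Site 2))) (h : ω ∈ openConnIn W u z) :
    ω ∈ Arm[u, (N : ℤ)] := by
  have hz' : (N : ℤ) ≤ max |z 0| |z 1| := by
    rw [Finset.mem_coe, mem_box, Fin.forall_fin_two] at hz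
    by_contra hlt
    rw [not_le, max_lt_iff, abs_lt, abs_lt] at hlt
    exact hz ⟨⟨by omega, by omega⟩, by omega, by omega⟩
  obtain ⟨y, hy, hconn⟩ := exists_openConnIn_le_level hω (fun v : Site 2 => max |v 0| |v 1|)
    supNorm_le_of_adj (N : ℤ) hu hz' h
  have hyS := hconn.2.1
  have hy0 : 0 ≤ y 1 := (hW y hyS.2).1 hyS.1
  have hsub : W ∩ {v : Site 2 | max |v 0| |v 1| ≤ (N : ℤ)} ⊆ hbox[(N : ℤ)] := by
    rintro v ⟨hvW, hv⟩
    have hv' : max |v 0| |v 1| ≤ (N : ℤ) := hv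
    have hv0 : 0 ≤ v 1 := (hW v hv').1 hvW
    refine ⟨hv0, ?_⟩
    rw [← abs_of_nonneg hv0]
    exact hv'
  refine ⟨u, mem_singleton _, y, ?_, Literature.Probability.Percolation.openConnIn_mono hsub _ _ hconn⟩
  show max |y 0| (y 1) = N
  rw [← abs_of_nonneg hy0]
  exact hy

/-! ### Positivity: the open row segment -/

/-- A row point `(x, 0)` with `|x| ≤ n` lies in `hbox[n]`. [folklore] -/
theorem row_mem_hbox {n x : ℤ} (hx : |x| ≤ n) : (![x, 0] : Site 2) ∈ hbox[n] := by
  refine ⟨by simp, ?_⟩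
  simp only [Matrix.cons_val_zero, Matrix.cons_val_one, Matrix.cons_val_fin_one]
  exact max_le hx ((abs_nonneg x).trans hx)

/-- If the `L` edges of the row segment from `(x₁, 0)` to `(x₁ + L, 0)` are open and the segment
lies in `[-n, n]`, then `(x₁, 0) ↔ (x₁ + L, 0)` inside `hbox[n]`. [folklore] -/
theorem openConnIn_row {ω : BondConfig (Site 2)} {n x₁ : ℤ} {L : ℕ} (hx₁ : -n ≤ x₁)
    (hL : x₁ + L ≤ n)
    (hF : ∀ j : ℕ, j < L → s((![x₁ + j, 0] : Site 2), ![x₁ + j + 1, 0]) ∈ ω) :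
    ω ∈ openConnIn hbox[n] ![x₁, 0] ![x₁ + L, 0] := by
  induction L with
  | zero =>
    simp only [Nat.cast_zero, add_zero]
    exact openConnIn_refl (row_mem_hbox (abs_le.2 ⟨hx₁, by push_cast at hL; omega⟩))
  | succ L ih =>
    push_cast at hL ⊢
    have h1 := ih (by omega) (fun j hj => hF j (by omega))
    have h2 : ω ∈ openConnIn hbox[n] ![x₁ + L, 0] ![x₁ + (L + 1), 0] := by
      rw [← add_assoc]
      refine openConnIn_of_adj (row_mem_hbox (abs_le.2 ⟨by omega, by omega⟩))
        (row_mem_hbox (abs_le.2 ⟨by omega, by omega⟩)) (hF L (by omega)) ?_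
      intro heq
      have := congr_fun heq 0
      simp at this
    exact PlanarDuality.openConnIn_trans h1 h2

/-- **The connection probability of two row points inside the half-box is positive**: the row
segment between them is open with probability `2^{-L}`. [folklore] -/
theorem real_openConnIn_row_pos {n : ℤ} {u w : Site 2} (hu1 : u 1 = 0) (hw1 : w 1 = 0)
    (hu : |u 0| ≤ n) (hw : |w 0| ≤ n) : 0 < (μ).real (openConnIn hbox[n] u w) := by
  wlog huw : u 0 ≤ w 0 generalizing u w
  · rw [openConnIn_comm]
    exact this hw1 hu1 hw hu (by omega)
  rw [abs_le] at hu hw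
  set L : ℕ := (w 0 - u 0).toNat with hL
  have hLeq : u 0 + (L : ℤ) = w 0 := by rw [hL, Int.toNat_of_nonneg (by omega)]; ring
  set F : Finset (Sym2 (Site 2)) :=
    (Finset.range L).image fun j : ℕ => s((![u 0 + j, 0] : Site 2), ![u 0 + j + 1, 0]) with hFdef
  have hFE : (↑F : Set (Sym2 (Site 2))) ⊆ (zdGraph 2).edgeSet := by
    intro e he
    rw [hFdef, Finset.coe_image, Set.mem_image] at he
    obtain ⟨j, -, rfl⟩ := he
    rw [SimpleGraph.mem_edgeSet, zdGraph_adj_iff]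
    exact ⟨0, Or.inl (pt_succ_eq _ _)⟩
  have hsub : {ω : BondConfig (Site 2) | (↑F : Set (Sym2 (Site 2))) ⊆ ω} ⊆ openConnIn hbox[n] u w := by
    intro ω hω
    have hu' : u = ![u 0, 0] := by
      funext i; fin_cases i
      · rfl
      · simpa using hu1
    have hw' : w = ![u 0 + (L : ℤ), 0] := by
      funext i; fin_cases i
      · simp [hLeq]
      · simpa using hw1
    rw [hu', hw']
    refine openConnIn_row (by omega) (by omega) (fun j hj => hω ?_)
    rw [Finset.mem_coe, hFdef, Finset.mem_image]
    exact ⟨j, Finset.mem_range.2 hj, rfl⟩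
  calc (0 : ℝ) < ((half : unitInterval) : ℝ) ^ F.card := by rw [coe_half]; positivity
    _ = (μ).real {ω : BondConfig (Site 2) | (↑F : Set (Sym2 (Site 2))) ⊆ ω} :=
        (bondPercolation_real_setOf_subset _ half F hFE).symm
    _ ≤ _ := measureReal_mono hsub (measure_ne_top _ _)

/-! ### The two-point function of a flat domain against the half-box -/

/-- **Core comparison.** There are `c > 0`, `ε ∈ (0, 1]`, `k₀ ≥ 1` such that for all `k ≥ k₀`, `J`,
`N` with `(4k + 1) 2^(J+1) ≤ N`, every `W ⊆ ℤ²` agreeing with the upper half-plane on the sup-norm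
ball of radius `N`, and all row points `u, w` with `|u 0|, |w 0| ≤ k`:
`0 < P[u ↔ w in hbox[N]] ≤ P[u ↔ w in W] ≤ (1 + (1 - ε)^J / c) · P[u ↔ w in hbox[N]]`
(lower bound: `hbox[N] ⊆ W`; upper bound: the decomposition `s10_connectionDecomposition` with
the window `B(N)`, `W ∩ B(N) ⊆ hbox[N]`, `arm_of_escape` and `twoArm_bound`). [folklore] -/
theorem twoPoint_core : ∃ c : ℝ, 0 < c ∧ ∃ ε : ℝ, 0 < ε ∧ ε ≤ 1 ∧ ∃ k₀ : ℕ, 1 ≤ k₀ ∧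
    ∀ k J N : ℕ, k₀ ≤ k → (4 * k + 1) * 2 ^ (J + 1) ≤ N → ∀ W : Set (Site 2),
    (∀ v : Site 2, max |v 0| |v 1| ≤ N → (v ∈ W ↔ 0 ≤ v 1)) → ∀ u w : Site 2, u 1 = 0 → w 1 = 0 →
    |u 0| ≤ k → |w 0| ≤ k →
    0 < (μ).real (openConnIn hbox[(N : ℤ)] u w) ∧
    (μ).real (openConnIn hbox[(N : ℤ)] u w) ≤ (μ).real (openConnIn W u w) ∧
    (μ).real (openConnIn W u w) ≤ (1 + (1 - ε) ^ J / c) * (μ).real (openConnIn hbox[(N : ℤ)] u w) := by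
  obtain ⟨c, hc, ε, hε, hε1, k₀, hk₀, h⟩ := twoArm_bound
  refine ⟨c, hc, ε, hε, hε1, k₀, hk₀, fun k J N hk hN W hW u w hu1 hw1 hu hw => ?_⟩
  have hkN : (k : ℤ) ≤ N := by
    have h1 : 1 ≤ 2 ^ (J + 1) := Nat.one_le_two_pow
    have : k ≤ N := by nlinarith
    exact_mod_cast this
  have huN : |u 0| ≤ (N : ℤ) := hu.trans hkN
  have hwN : |w 0| ≤ (N : ℤ) := hw.trans hkN
  have hHW : hbox[(N : ℤ)] ⊆ W := fun v hv => by
    have h' : max |v 0| |v 1| ≤ N := by rw [abs_of_nonneg hv.1]; exact hv.2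
    exact (hW v h').2 hv.1
  refine ⟨real_openConnIn_row_pos hu1 hw1 huN hwN,
    measureReal_mono (Literature.Probability.Percolation.openConnIn_mono hHW u w) (measure_ne_top _ _), ?_⟩
  have hWS : W ∩ ↑(box 2 N) ⊆ hbox[(N : ℤ)] := by
    rintro v ⟨hvW, hvB⟩
    rw [Finset.mem_coe, mem_box, Fin.forall_fin_two] at hvB
    have hvn : max |v 0| |v 1| ≤ N := max_le (abs_le.2 ⟨hvB.1.1, hvB.1.2⟩) (abs_le.2 ⟨hvB.2.1, hvB.2.2⟩)
    have hv0 : 0 ≤ v 1 := (hW v hvn).1 hvW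
    exact ⟨hv0, by rw [← abs_of_nonneg hv0]; exact hvn⟩
  have huS : max |u 0| |u 1| ≤ N := by rw [hu1, abs_zero]; exact max_le huN (by positivity)
  have hwS : max |w 0| |w 1| ≤ N := by rw [hw1, abs_zero]; exact max_le hwN (by positivity)
  have hesc : (μ).real ({ω | ∃ z, z ∉ (↑(box 2 N) : Set (Site 2)) ∧ ω ∈ openConnIn W u z} ∩
      {ω | ∃ z, z ∉ (↑(box 2 N) : Set (Site 2)) ∧ ω ∈ openConnIn W w z}) ≤
      (μ).real (Arm[u, (N : ℤ)] ∩ Arm[w, (N : ℤ)]) := by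
    refine ENNReal.toReal_mono (measure_ne_top _ _) (measure_mono_ae ?_)
    filter_upwards [ae_subset_edgeSet (zdGraph 2) half] with ω hω h'
    obtain ⟨⟨z, hz, hz'⟩, ⟨z', hz₁, hz₁'⟩⟩ := h'
    exact ⟨arm_of_escape hω hW huS hz hz', arm_of_escape hω hW hwS hz₁ hz₁'⟩
  have harm := h k J N hk hN u w hu1 hw1 hu hw
  calc (μ).real (openConnIn W u w)
      ≤ (μ).real (openConnIn (W ∩ ↑(box 2 N)) u w ∪
          ({ω | ∃ z, z ∉ (↑(box 2 N) : Set (Site 2)) ∧ ω ∈ openConnIn W u z} ∩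
            {ω | ∃ z, z ∉ (↑(box 2 N) : Set (Site 2)) ∧ ω ∈ openConnIn W w z})) :=
        measureReal_mono (openConnIn_subset W _ u w) (measure_ne_top _ _)
    _ ≤ (μ).real (openConnIn (W ∩ ↑(box 2 N)) u w) +
          (μ).real ({ω | ∃ z, z ∉ (↑(box 2 N) : Set (Site 2)) ∧ ω ∈ openConnIn W u z} ∩
            {ω | ∃ z, z ∉ (↑(box 2 N) : Set (Site 2)) ∧ ω ∈ openConnIn W w z}) :=
        measureReal_union_le _ _
    _ ≤ (μ).real (openConnIn hbox[(N : ℤ)] u w) +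
          (1 - ε) ^ J / c * (μ).real (openConnIn hbox[(N : ℤ)] u w) :=
        add_le_add (measureReal_mono (Literature.Probability.Percolation.openConnIn_mono hWS u w)
          (measure_ne_top _ _)) (hesc.trans harm)
    _ = (1 + (1 - ε) ^ J / c) * (μ).real (openConnIn hbox[(N : ℤ)] u w) := by ring

/-! ### Locality of the two-point function in the `Site 2` phrasing, anchors at the origin -/

/-- **Locality of the two-point function near a flat boundary (anchors at the origin).** For every
`ε > 0` there is `M₀ > 0` such that for all `W, W' ⊆ ℤ²` agreeing with the upper half-plane on the
Euclidean ball of radius `M·m` about the origin (`m ≥ 1`, `M ≥ M₀`) and all row points `u, w`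
with `(u 0)², (w 0)² ≤ m²`, the connection probabilities `P[u ↔ w in W]`, `P[u ↔ w in W']` are
positive and their logarithms differ by at most `ε` (both are within a factor `1 + θ`,
`θ = (1 - ε_b)^J / c < ε`, of `P[u ↔ w in hbox[N]]`, `N = ⌊M m / 2⌋`, by `twoPoint_core` at the
scale `k = max ⌈m⌉ k₀`). [folklore] -/
theorem twoPoint_locality_site : ∀ ε : ℝ, 0 < ε → ∃ M₀ : ℝ, 0 < M₀ ∧
    ∀ (W W' : Set (Site 2)) (u w : Site 2) (m M : ℝ), 1 ≤ m → M₀ ≤ M →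
    (∀ v : Site 2, (((v 0) ^ 2 + (v 1) ^ 2 : ℤ) : ℝ) ≤ (M * m) ^ 2 → (v ∈ W ↔ 0 ≤ v 1)) →
    (∀ v : Site 2, (((v 0) ^ 2 + (v 1) ^ 2 : ℤ) : ℝ) ≤ (M * m) ^ 2 → (v ∈ W' ↔ 0 ≤ v 1)) →
    u 1 = 0 → w 1 = 0 → (((u 0) ^ 2 : ℤ) : ℝ) ≤ m ^ 2 → (((w 0) ^ 2 : ℤ) : ℝ) ≤ m ^ 2 →
    0 < (μ).real (openConnIn W u w) ∧ 0 < (μ).real (openConnIn W' u w) ∧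
    |Real.log ((μ).real (openConnIn W u w)) - Real.log ((μ).real (openConnIn W' u w))| ≤ ε := by
  intro ε hε
  obtain ⟨c, hc, εb, hεb, hεb1, k₀, hk₀, hcore⟩ := twoPoint_core
  obtain ⟨J, hJ⟩ := exists_pow_lt_of_lt_one (show 0 < c * ε by positivity) (show 1 - εb < 1 by linarith)
  set θ := (1 - εb) ^ J / c with hθdef
  have hθ0 : 0 ≤ θ := div_nonneg (pow_nonneg (by linarith) J) hc.le
  have hθε : θ ≤ ε := by
    rw [hθdef, div_le_iff₀ hc]
    linarith [mul_comm c ε]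
  refine ⟨(8 * k₀ + 20) * 2 ^ (J + 1), by positivity,
    fun W W' u w m M hm hM hW hW' hu1 hw1 hu hw => ?_⟩
  set k : ℕ := max ⌈m⌉₊ k₀ with hk
  set N : ℕ := ⌊M * m / 2⌋₊ with hN
  have hm0 : 0 ≤ m := by linarith
  have hM0 : 0 < M := lt_of_lt_of_le (by positivity) hM
  have hk₀k : k₀ ≤ k := le_max_right _ _
  have hkm : (k : ℝ) ≤ m + k₀ + 1 := by
    have h1 : (⌈m⌉₊ : ℝ) < m + 1 := Nat.ceil_lt_add_one hm0
    have h2 : k ≤ ⌈m⌉₊ + k₀ := max_le (Nat.le_add_right _ _) (Nat.le_add_left _ _)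
    have h3 : (k : ℝ) ≤ ⌈m⌉₊ + k₀ := by exact_mod_cast h2
    linarith
  have hNle : (N : ℝ) ≤ M * m / 2 := Nat.floor_le (by positivity)
  -- the scales fit
  have hscale : (4 * k + 1) * 2 ^ (J + 1) ≤ N := by
    refine Nat.le_floor ?_
    push_cast
    have h1 : (4 * (k : ℝ) + 1) ≤ (4 * k₀ + 9) * m := by nlinarith
    calc (4 * (k : ℝ) + 1) * 2 ^ (J + 1) ≤ (4 * k₀ + 9) * m * 2 ^ (J + 1) := by gcongr
      _ ≤ (4 * k₀ + 10) * m * 2 ^ (J + 1) := by gcongr; linarith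
      _ = ((8 * k₀ + 20) * 2 ^ (J + 1)) * m / 2 := by ring
      _ ≤ M * m / 2 := by gcongr
  -- flatness in the sup-norm form
  have flat : ∀ {X : Set (Site 2)}, (∀ v : Site 2, (((v 0) ^ 2 + (v 1) ^ 2 : ℤ) : ℝ) ≤ (M * m) ^ 2 →
      (v ∈ X ↔ 0 ≤ v 1)) → ∀ v : Site 2, max |v 0| |v 1| ≤ N → (v ∈ X ↔ 0 ≤ v 1) := by
    intro X hX v hv
    refine hX v ?_
    rw [max_le_iff] at hv
    have h0 : ((|v 0| : ℤ) : ℝ) ≤ N := by exact_mod_cast hv.1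
    have h1 : ((|v 1| : ℤ) : ℝ) ≤ N := by exact_mod_cast hv.2
    push_cast at h0 h1 ⊢
    have hMm : 0 ≤ M * m := by positivity
    nlinarith [abs_nonneg ((v 0 : ℤ) : ℝ), abs_nonneg ((v 1 : ℤ) : ℝ), sq_abs ((v 0 : ℤ) : ℝ),
      sq_abs ((v 1 : ℤ) : ℝ)]
  -- the points are at scale `k`
  have habs : ∀ {x : ℤ}, (((x ^ 2 : ℤ)) : ℝ) ≤ m ^ 2 → |x| ≤ (k : ℤ) := by
    intro x hx
    have h1 : |(x : ℝ)| ≤ m := by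
      have : |(x : ℝ)| ≤ |m| := sq_le_sq.1 (by push_cast at hx; exact hx)
      rwa [abs_of_nonneg hm0] at this
    have h2 : m ≤ k := le_trans (Nat.le_ceil m) (by exact_mod_cast le_max_left _ _)
    have : ((|x| : ℤ) : ℝ) ≤ k := by push_cast; linarith
    exact_mod_cast this
  obtain ⟨hpos, hlow, hup⟩ := hcore k J N hk₀k hscale W (flat hW) u w hu1 hw1 (habs hu) (habs hw)
  obtain ⟨-, hlow', hup'⟩ := hcore k J N hk₀k hscale W' (flat hW') u w hu1 hw1 (habs hu) (habs hw)
  have hPW : 0 < (μ).real (openConnIn W u w) := lt_of_lt_of_le hpos hlow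
  have hPW' : 0 < (μ).real (openConnIn W' u w) := lt_of_lt_of_le hpos hlow'
  refine ⟨hPW, hPW', ?_⟩
  have hlog1 : Real.log (1 + θ) ≤ θ := by
    linarith [Real.log_le_sub_one_of_pos (show 0 < 1 + θ by positivity)]
  have key : ∀ {P : ℝ}, (μ).real (openConnIn hbox[(N : ℤ)] u w) ≤ P →
      P ≤ (1 + θ) * (μ).real (openConnIn hbox[(N : ℤ)] u w) →
      Real.log ((μ).real (openConnIn hbox[(N : ℤ)] u w)) ≤ Real.log P ∧
      Real.log P ≤ Real.log ((μ).real (openConnIn hbox[(N : ℤ)] u w)) + θ := by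
    intro P h1 h2
    refine ⟨Real.log_le_log hpos h1, ?_⟩
    calc Real.log P ≤ Real.log ((1 + θ) * (μ).real (openConnIn hbox[(N : ℤ)] u w)) :=
          Real.log_le_log (lt_of_lt_of_le hpos h1) h2
      _ = Real.log (1 + θ) + Real.log ((μ).real (openConnIn hbox[(N : ℤ)] u w)) :=
          Real.log_mul (by positivity) hpos.ne'
      _ ≤ _ := by linarith
  obtain ⟨a1, a2⟩ := key hlow hup
  obtain ⟨b1, b2⟩ := key hlow' hup'
  rw [abs_sub_le_iff]
  constructor <;> linarith

/-! ### Translation and the `ℤ × ℤ` phrasing of the stub -/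

/-- Membership in the image of a `ℤ × ℤ`-domain under the coordinate embedding (coerced to a
set of sites). [folklore] -/
theorem mem_coe_image_vec2 (V : Finset (ℤ × ℤ)) (s : Site 2) :
    s ∈ (↑(V.image (fun v : ℤ × ℤ => (![v.1, v.2] : Fin 2 → ℤ))) : Set (Site 2)) ↔ (s 0, s 1) ∈ V := by
  rw [Finset.mem_coe, Finset.mem_image]
  constructor
  · rintro ⟨v, hv, rfl⟩
    simpa using hv
  · intro h
    exact ⟨(s 0, s 1), h, by funext i; fin_cases i <;> rfl⟩

/-- **Translation invariance of restricted connection probabilities** on `ℤ²`: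
`P[x + t ↔ y + t in S + t] = P[x ↔ y in S]` (`real_openCrossing_shift` for singletons). [folklore] -/
theorem real_openConnIn_shift (S : Set (Site 2)) (x y t : Site 2) :
    (μ).real (openConnIn ((· + t) '' S) (x + t) (y + t)) = (μ).real (openConnIn S x y) := by
  have h1 : ∀ (T : Set (Site 2)) (a b : Site 2), openConnIn T a b = openCrossing T {a} {b} := by
    intro T a b
    ext ω
    simp
  rw [h1, h1, ← Set.image_singleton (f := (· + t)) (a := x), ← Set.image_singleton (f := (· + t)) (a := y)]
  exact real_openCrossing_shift half t S {x} {y}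

/-- Flatness at the anchor `a` of a `ℤ × ℤ`-domain `V` is flatness at the origin of the shifted
embedded domain `{s | s + (a.1, a.2) ∈ V}`. [folklore] -/
theorem flat_shift {V : Finset (ℤ × ℤ)} {a : ℤ × ℤ} {ρ : ℝ}
    (hV : ∀ v : ℤ × ℤ, ((((v.1 - a.1) ^ 2 + (v.2 - a.2) ^ 2 : ℤ) : ℝ)) ≤ ρ ^ 2 → (v ∈ V ↔ 0 ≤ v.2 - a.2)) :
    ∀ s : Site 2, (((s 0) ^ 2 + (s 1) ^ 2 : ℤ) : ℝ) ≤ ρ ^ 2 →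
      (s ∈ (fun x : Site 2 => x + ![a.1, a.2]) ⁻¹'
        (↑(V.image (fun v : ℤ × ℤ => (![v.1, v.2] : Fin 2 → ℤ))) : Set (Site 2)) ↔ 0 ≤ s 1) := by
  intro s hs
  rw [Set.mem_preimage, mem_coe_image_vec2]
  have h := hV (s 0 + a.1, s 1 + a.2) (by simpa using hs)
  simp only [Pi.add_apply, Matrix.cons_val_zero, Matrix.cons_val_one, Matrix.cons_val_fin_one]
  rw [h]
  constructor <;> intro h' <;> linarith

/-- **Locality of the two-point function near a flat boundary, `ℤ × ℤ` phrasing** (the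
percolation half P1 of `stub_clusterLocalityV2` for the family `(2;2)`): for every `ε > 0` there
is `M₀ > 0` such that for finite `V, V' ⊆ ℤ × ℤ` agreeing with the half-planes `{0 ≤ v.2 - a.2}`,
`{0 ≤ v.2 - a'.2}` on the balls of radius `M·m` about the anchors `a`, `a'` (`m ≥ 1`, `M ≥ M₀`)
and row points `u, w` within horizontal distance `m` of `a`, the critical bond-percolation
probabilities of `{u ↔ w in V}` and of `{u - a + a' ↔ w - a + a' in V'}` are positive and their
logarithms differ by at most `ε` (translate both to the origin, `real_openConnIn_shift`, and apply
`twoPoint_locality_site`). [folklore] -/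
theorem twoPoint_locality_Z2 : ∀ ε : ℝ, 0 < ε → ∃ M₀ : ℝ, 0 < M₀ ∧
    ∀ (V V' : Finset (ℤ × ℤ)) (a a' u w : ℤ × ℤ) (m M : ℝ), 1 ≤ m → M₀ ≤ M →
    (∀ v : ℤ × ℤ, ((((v.1 - a.1) ^ 2 + (v.2 - a.2) ^ 2 : ℤ) : ℝ)) ≤ (M * m) ^ 2 →
      (v ∈ V ↔ 0 ≤ v.2 - a.2)) →
    (∀ v : ℤ × ℤ, ((((v.1 - a'.1) ^ 2 + (v.2 - a'.2) ^ 2 : ℤ) : ℝ)) ≤ (M * m) ^ 2 →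
      (v ∈ V' ↔ 0 ≤ v.2 - a'.2)) →
    u.2 = a.2 → w.2 = a.2 → (((u.1 - a.1) ^ 2 : ℤ) : ℝ) ≤ m ^ 2 → (((w.1 - a.1) ^ 2 : ℤ) : ℝ) ≤ m ^ 2 →
    u ≠ w →
    0 < (μ).real (openConnIn (↑(V.image (fun v : ℤ × ℤ => (![v.1, v.2] : Fin 2 → ℤ))) : Set (Site 2))
      (![u.1, u.2] : Fin 2 → ℤ) (![w.1, w.2] : Fin 2 → ℤ)) ∧
    0 < (μ).real (openConnIn (↑(V'.image (fun v : ℤ × ℤ => (![v.1, v.2] : Fin 2 → ℤ))) : Set (Site 2))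
      (![(u - a + a').1, (u - a + a').2] : Fin 2 → ℤ) (![(w - a + a').1, (w - a + a').2] : Fin 2 → ℤ)) ∧
    |Real.log ((μ).real (openConnIn (↑(V.image (fun v : ℤ × ℤ => (![v.1, v.2] : Fin 2 → ℤ))) : Set (Site 2))
        (![u.1, u.2] : Fin 2 → ℤ) (![w.1, w.2] : Fin 2 → ℤ))) -
      Real.log ((μ).real (openConnIn (↑(V'.image (fun v : ℤ × ℤ => (![v.1, v.2] : Fin 2 → ℤ))) : Set (Site 2))
        (![(u - a + a').1, (u - a + a').2] : Fin 2 → ℤ) (![(w - a + a').1, (w - a + a').2] : Fin 2 → ℤ)))| ≤ ε := by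
  intro ε hε
  obtain ⟨M₀, hM₀, h⟩ := twoPoint_locality_site ε hε
  refine ⟨M₀, hM₀, fun V V' a a' u w m M hm hM hV hV' hu2 hw2 hu1 hw1 _ => ?_⟩
  set A : Site 2 := ![a.1, a.2] with hA
  set A' : Site 2 := ![a'.1, a'.2] with hA'
  set W : Set (Site 2) := (fun x : Site 2 => x + A) ⁻¹'
    (↑(V.image (fun v : ℤ × ℤ => (![v.1, v.2] : Fin 2 → ℤ))) : Set (Site 2)) with hWdef
  set W' : Set (Site 2) := (fun x : Site 2 => x + A') ⁻¹'
    (↑(V'.image (fun v : ℤ × ℤ => (![v.1, v.2] : Fin 2 → ℤ))) : Set (Site 2)) with hW'def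
  set U : Site 2 := ![u.1 - a.1, 0] with hU
  set X : Site 2 := ![w.1 - a.1, 0] with hX
  have key := h W W' U X m M hm hM (flat_shift hV) (flat_shift hV') (by simp [hU]) (by simp [hX])
    (by simpa [hU] using hu1) (by simpa [hX] using hw1)
  have eW : (fun x : Site 2 => x + A) '' W = ↑(V.image (fun v : ℤ × ℤ => (![v.1, v.2] : Fin 2 → ℤ))) :=
    Set.image_preimage_eq _ (add_right_surjective A)
  have eW' : (fun x : Site 2 => x + A') '' W' = ↑(V'.image (fun v : ℤ × ℤ => (![v.1, v.2] : Fin 2 → ℤ))) :=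
    Set.image_preimage_eq _ (add_right_surjective A')
  have eU : U + A = ![u.1, u.2] := by funext i; fin_cases i <;> simp [hU, hA, hu2]
  have eX : X + A = ![w.1, w.2] := by funext i; fin_cases i <;> simp [hX, hA, hw2]
  have eU' : U + A' = ![(u - a + a').1, (u - a + a').2] := by
    funext i; fin_cases i <;> simp [hU, hA', hu2]
  have eX' : X + A' = ![(w - a + a').1, (w - a + a').2] := by
    funext i; fin_cases i <;> simp [hX, hA', hw2]
  have e1 := real_openConnIn_shift W U X A
  have e2 := real_openConnIn_shift W' U X A'
  rw [eW, eU, eX] at e1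
  rw [eW', eU', eX'] at e2
  rw [e1, e2]
  exact key

/-! ### Registered sub-goal of the stub carried by this file -/

/-- **Sub-goal `s12_twoPointLocality`** (registered on stmt-CriticalPhenomena-14132): the
percolation half P1 of `stub_clusterLocalityV2` for the family `(2;2)` in the stub's own `ℤ × ℤ`
phrasing (`twoPoint_locality_Z2`). [folklore] -/
theorem s12_twoPointLocality : ∀ ε : ℝ, 0 < ε → ∃ M₀ : ℝ, 0 < M₀ ∧ ∀ (V V' : Finset (ℤ × ℤ)) (a a' u w : ℤ × ℤ) (m M : ℝ), 1 ≤ m → M₀ ≤ M → (∀ v : ℤ × ℤ, ((((v.1 - a.1) ^ 2 + (v.2 - a.2) ^ 2 : ℤ) : ℝ)) ≤ (M * m) ^ 2 → (v ∈ V ↔ 0 ≤ v.2 - a.2)) → (∀ v : ℤ × ℤ, ((((v.1 - a'.1) ^ 2 + (v.2 - a'.2) ^ 2 : ℤ) : ℝ)) ≤ (M * m) ^ 2 → (v ∈ V' ↔ 0 ≤ v.2 - a'.2)) → u.2 = a.2 → w.2 = a.2 → (((u.1 - a.1) ^ 2 : ℤ) : ℝ) ≤ m ^ 2 → (((w.1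 - a.1) ^ 2 : ℤ) : ℝ) ≤ m ^ 2 → u ≠ w → 0 < (Literature.Probability.Percolation.bondPercolation (Literature.Probability.LatticeModels.zdGraph 2) Literature.Probability.Percolation.half).real (Literature.Probability.Percolation.openConnIn (↑(V.image (fun v : ℤ × ℤ => (![v.1, v.2] : Fin 2 → ℤ))) : Set (Fin 2 → ℤ)) (![u.1, u.2] : Fin 2 → ℤ) (![w.1, w.2] : Fin 2 → ℤ)) ∧ 0 < (Literature.Probability.Percolation.bondPercolation (Literature.Probability.LatticeModels.zdGraph 2) Literature.Probability.Percolation.half).real (Literature.Probability.Percolation.openConnIn (↑(V'.image (fun v : ℤ × ℤ => (![v.1, v.2] : Fin 2 → ℤ))) : Set (Fin 2 → ℤ)) (![(u - a + a').1, (u - a + a').2] : Fin 2 → ℤ) (![(w - a + a').1, (w - a + a').2] : Fin 2 → ℤ)) ∧ |Real.log ((Literature.Probability.Percolation.bondPercolation (Literature.Probability.LatticeModels.zdGraph 2) Literature.Probability.Percolation.half).real (Literature.Probability.Percolation.openConnIn (↑(V.image (fun v : ℤ × ℤ => (![v.1, v.2] : Fin 2 → ℤ))) : Set (Fin 2 →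 ℤ)) (![u.1, u.2] : Fin 2 → ℤ) (![w.1, w.2] : Fin 2 → ℤ))) - Real.log ((Literature.Probability.Percolation.bondPercolation (Literature.Probability.LatticeModels.zdGraph 2) Literature.Probability.Percolation.half).real (Literature.Probability.Percolation.openConnIn (↑(V'.image (fun v : ℤ × ℤ => (![v.1, v.2] : Fin 2 → ℤ))) : Set (Fin 2 → ℤ)) (![(u - a + a').1, (u - a + a').2] : Fin 2 → ℤ) (![(w - a + a').1, (w - a + a').2] : Fin 2 → ℤ)))| ≤ ε :=
  twoPoint_locality_Z2

end Summit.CriticalPhenomena.CardyFormulaZ2.Cruxes.BoundaryDefectGaussianR.RainbowMonomialsInExcursionKernels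

end
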